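import Literature.MathematicalPhysics.KineticTheory.HierarchyTimeSeparationBlocks
import Literature.MathematicalPhysics.KineticTheory.HierarchyEnergyTruncation
import HarnessLib

/-!
# Term-by-term comparison of two coupled hierarchies (BGSR Props. 5.3, 5.6, 5.7: abstract form)
(Bodineau–Gallagher–Saint-Raymond, Invent. Math. 203 (2016) = arXiv:1305.3397v2, §5 "Proof of
the convergence": §5.1 (the pseudo-trajectories of the two hierarchies and their coupling),
Proposition 5.3 (the induction along the collision tree), Propositions 5.6 and 5.7 (the error of
the coupling is paid once per collision operator and propagated by the continuity estimates of
Lemma 4.2), pp. 15–21 of the held text; trunk T-KINETIC, topic MathematicalPhysics/KineticTheory;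
the ABSTRACT layer of the comparison step of the bottom-up plan towards the named fact
`bgsr_linearBoltzmannApprox` (`TaggedSphereDiffusion`) recorded in `TaggedSphereLinearBoltzmannRate`,
on top of the separated Duhamel terms `HierarchyTimeSeparation(Blocks)` (N5d₂–N5d₃).)

BGSR §5 compare the main terms `f^{(1,K)}_{N,E,δ}` and `g^{(1,K)}_{α,E,δ}` of the pruned, energy-truncated,
time-separated expansions of the BBGKY and Boltzmann hierarchies term by term: *"The main heuristic
idea is that the pseudo-trajectories associated to both hierarchies can be coupled precisely if no
recollisions occur in the BBGKY hierarchy"* (p. 15); Proposition 5.3 builds the coupling inductively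
along the collision tree (at each collision the adjoined particle is chosen outside a bad set, after
which the two configurations are again close and good), and Propositions 5.6–5.7 turn it into the
estimate: *"In the usual continuity estimate for the elementary collision operator, the integration
with respect to velocity brings a factor `(2π/β)^{d/2}`, while removing the integration over the
pathological set `B_k^{m_k}` gives an error (5.22) … For a given `J`, there are `J_K - 1 ≤ A^{K+1}`
possible choices of the integral to be modified"* (p. 20), and *"the prefactors `(N-k)ε^{d-1}/α`
that can be replaced in the limit by `1` … Discrepancy between `f_N^{0(J_K)}(Z_{J_K}(0))` and
`g^{0(J_K)}(Z^0_{J_K}(0))`"* (p. 21).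

This file formalises the INDUCTION of this argument once, for two abstract hierarchy models
`M₁`, `M₂` (`Kinetic.HierarchyModel`, N4a) on the same phase spaces, in the nested form in which
the tree writes the main terms (`HierarchyModel.sepTerm`, `sepBlockOp`, `sepBlockComp`: the sum over
the labels `m` of BGSR's pseudo-trajectories sits inside each collision operator). The coupling is
an abstract family of relations `𝒞.rel k σ ⊆ Config k × Config k` ("coupled pairs of `k`-particle
configurations, good for the backward horizon `σ` after the delay `δ`", `HierarchyModel.Coupling`)
stable under the two backward transports (`Coupling.trans`), and the geometric–measure-theoretic
content of Props. 5.1/5.3/5.6/5.7 is abstracted into ONE hypothesis on one collision operator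
(`Coupling.RelStep`): if two level-`(k+1)` densities are `η_r`-close on coupled pairs (and obey the
a priori Gaussian bound `K` and the energy cut-off), then the two collision operators applied to
them, read at the transports of a coupled level-`k` pair, differ by at most `(Λ_rel η_r + E_rel K)`
times the Gaussian weight — for almost every transport time (the pathological, measure-zero set of
parameters on which the hard-sphere pseudo-trajectory is ill-defined, BGSR p. 15 "[Simonella]", is
invisible inside the time integrals). From this the file PROVES:

* `HierarchyModel.sepTerm_eq_zero_of_lt` (`…sepBlockOp…`, `…sepBlockComp…`) — separated terms of
  energy-truncated data vanish above the cut-off (for models whose collision operators preserve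
  this vanishing, hypothesis `hV`);
* `Coupling.abs_sepTerm_sub_sepTerm_le` — **the relational chain estimate** (Prop. 5.3 + the
  mechanism of Props. 5.6–5.7 for one elementary term): if the data are `η_r`-close on transported
  coupled pairs at the top level then
  `|Q^{δ,1}_{s,s+n}(t) G₁ (Z) - Q^{δ,2}_{s,s+n}(t) G₂ (Y)| ≤ (η_r + n θ K) Λⁿ tⁿ/n! e^{-λ₀ H(Y)}`
  on coupled pairs `(Z, Y)` — the discrepancy of the data propagated by the chain cost `Λ`, plus an
  error `θ K` paid once per collision operator ("`J_K - 1` possible choices of the integral to be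
  modified");
* `Coupling.isRelLevelBddD_sepBlockOp`, `Coupling.isRelLevelBddT_of_D` — one separated block maps
  relational level bounds `(η_R, R) ↦ ((η_R + n θ R) E_b, R E_b)`, `E_b = ∑_{j<n} (C₀ Λ h)^j/j!` the
  block factor of N4b;
* `Coupling.isRelLevelBddT_sepBlockComp`, `Coupling.abs_sepBlockComp_sub_sepBlockComp_le` — **the
  comparison of the main terms**: `|(sepBlockComp K [G₁])^{(1)}(Z) - (sepBlockComp K [G₂])^{(1)}(Y)|
  ≤ C₀ (η_R + R ∑_{b<K} n_b θ_b) ∏_{b<K} E_b` on coupled one-particle pairs (printed: Props. 5.6 +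
  5.7 summed over `J`, `A^{K(K+1)} (Cαt)^{A^{K+1}} × [A^{2(K+1)} (bad set) + A^{2(K+1)}/N + αε]`).

The instantiation (hard spheres on `T^d` vs. the Boltzmann hierarchy, BGSR's bad sets of Prop. 5.1
from `GoodConfigurations(Measure)`, the prefactors and the initial data of Props. 3.2–3.3) is NOT
here.

## Design choices

* Horizons and slack. A pair in `𝒞.rel k σ` may be transported backwards by any `s ∈ [δ, σ]`
  (every transport inside a separated term is by at least the separation `δ`, which is what makes
  BGSR's delay `δ` of Prop. 5.1 available, and by at most the remaining time); relational bounds on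
  data are stated at transported pairs (`IsRelLevelBddT`, slack `ς`: transport times `t ≤ σ - ς`
  leave the horizon `ς` needed by the inner blocks), relational bounds on composites directly
  (`IsRelLevelBddD`).
* Almost every transport time. `RelStep` asks the one-step comparison for `volume`-a.e. `s`; the
  induction transfers it to a.e. collision time `τ = t - s` (`measurePreserving_sub_left`) inside
  the interval integral, whose value only depends on the a.e. class of the integrand.
* Constants. `Λ` dominates the chain costs of both models and `Λ_rel`; the per-collision error is
  `E_rel ≤ θ Λ`; all weights are BGSR's Gaussian weights with the decrement bookkeeping of N3/N5d₂.

## References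

* T. Bodineau, I. Gallagher, L. Saint-Raymond, *The Brownian motion as the limit of a
  deterministic system of hard-spheres*, Invent. Math. 203 (2016) 493–553 = arXiv:1305.3397v2,
  §5.1–5.3, Props. 5.3, 5.6, 5.7, pp. 15–21.
* I. Gallagher, L. Saint-Raymond, B. Texier, *From Newton to Boltzmann* (2013), Ch. 12 and Lemma
  14.1.1 (the coupling of pseudo-trajectories), of which BGSR §5 is the torus version.
-/

open MeasureTheory Metric Real Set Filter Function
open scoped Nat Interval
open Literature.Analysis.FluidPDE (Config configEnergy GCState)

namespace Literature.MathematicalPhysics.KineticTheory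

noncomputable section

section Kinetic

variable {d : Type*} [Fintype d] {X : Type*} [MeasurableSpace X]

namespace HierarchyModel

/-! ## Couplings of two hierarchy models -/

/-- A *coupling* of two hierarchy models `M₁`, `M₂` on the same phase spaces, with delay `δ`:
for every particle number `k` and horizon `σ` a set `rel k σ` of *coupled pairs* `(Z, Y)` of
`k`-particle configurations (BGSR §5.1–5.2: the BBGKY pseudo-trajectory `Z` and the Boltzmann
pseudo-trajectory `Z⁰` "remain close for all times", positions `ā`-close, same velocities, `Z⁰`
good after the delay `δ`, Prop. 5.1 (5.11)/(5.13)), stable under the backward transports of the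
two models by any time `s ∈ [δ, σ]`, the horizon decreasing to `σ - s` (Prop. 5.3: "the recursion
hypothesis at step `i`", (5.16)). [cite: BodineauGallagherSaintRaymondInvent2016, §5.2.2 Prop. 5.3 (5.16), p. 18] -/
structure Coupling (M₁ M₂ : HierarchyModel d X) (δ : ℝ) where
  /-- The coupled pairs of `k`-particle configurations with backward horizon `σ`. -/
  rel : (k : ℕ) → ℝ → Set (Config k d X × Config k d X)
  /-- Coupled pairs stay coupled under the two backward transports by `s ∈ [δ, σ]`. -/
  trans : ∀ (k : ℕ) (σ : ℝ) (p : Config k d X × Config k d X), p ∈ rel k σ →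
    ∀ s ∈ Icc δ σ, (M₁.flow k (-s) p.1, M₂.flow k (-s) p.2) ∈ rel k (σ - s)

namespace Coupling

variable {M₁ M₂ : HierarchyModel d X} {δ : ℝ} (𝒞 : Coupling M₁ M₂ δ)

/-- **The one-step comparison hypothesis** (the content of BGSR Props. 5.1/5.3 and of the proofs
of Props. 5.6–5.7 for ONE collision operator, abstracted): with weight floor `λₘ`, decrement `η`,
at most `k_max + 1` particles, energy cut-off `E_c` and constants `Λ_rel, E_rel`: for every coupled
level-`k` pair `(Z, Y)` (`k ≤ k_max`) and almost every transport time `s ∈ [δ, σ]`, whenever two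
measurable level-`(k+1)` densities `g₁, g₂` obey the a priori bound `K e^{-(λ₀+η) H}`, vanish above
the energy `E_c`, and are `η_r e^{-(λ₀+η) H}`-close on the coupled level-`(k+1)` pairs of horizon
`σ - s`, the two collision operators applied to them at the transported pair differ by at most
`(Λ_rel η_r + E_rel K) e^{-λ₀ H}` ("removing the integration over the pathological set gives an
error (5.22)", "the prefactors … can be replaced in the limit by `1`", and the coupled remainder is
estimated by the continuity estimate). [cite: BodineauGallagherSaintRaymondInvent2016, §5.3.3 Props. 5.6-5.7, pp. 20–21] -/
def RelStep (Ec bm η : ℝ) (kmax : ℕ) (Λrel Erel : ℝ) : Prop :=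
  ∀ (k : ℕ), k ≤ kmax → ∀ (σ : ℝ) (p : Config k d X × Config k d X), p ∈ 𝒞.rel k σ →
    ∀ᵐ s : ℝ, s ∈ Icc δ σ →
      ∀ (g₁ g₂ : Config (k + 1) d X → ℝ) (K ηr b₀ : ℝ), bm ≤ b₀ → 0 ≤ K → 0 ≤ ηr →
        Measurable g₁ → Measurable g₂ →
        (∀ Z, |g₁ Z| ≤ K * exp (-(b₀ + η) * configEnergy Z)) →
        (∀ Z, |g₂ Z| ≤ K * exp (-(b₀ + η) * configEnergy Z)) →
        (∀ Z, Ec < configEnergy Z → g₁ Z = 0) → (∀ Z, Ec < configEnergy Z → g₂ Z = 0) →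
        (∀ q ∈ 𝒞.rel (k + 1) (σ - s),
          |g₁ q.1 - g₂ q.2| ≤ ηr * exp (-(b₀ + η) * configEnergy q.2)) →
        |M₁.op k g₁ (M₁.flow k (-s) p.1) - M₂.op k g₂ (M₂.flow k (-s) p.2)| ≤
          (Λrel * ηr + Erel * K) * exp (-b₀ * configEnergy (M₂.flow k (-s) p.2))

/-- Relational level bound, *transported form* with slack `ς`: at every level `a ≤ L`, on every
coupled pair of horizon `σ` transported by `t ∈ [δ, σ - ς]`, the two families differ by at most
`η_R C₀^a e^{-w H}` (the shape in which the discrepancy of the data — BGSR Prop. 5.7, second bullet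
— enters the chain estimate). [cite: BodineauGallagherSaintRaymondInvent2016, §5.3.3 Prop. 5.7, p. 21] -/
def IsRelLevelBddT (G₁ G₂ : GCState d X) (L : ℕ) (ηR C₀ w ς : ℝ) : Prop :=
  ∀ a ≤ L, ∀ (σ : ℝ) (p : Config a d X × Config a d X), p ∈ 𝒞.rel a σ → ∀ t ∈ Icc δ (σ - ς),
    |G₁ a (M₁.flow a (-t) p.1) - G₂ a (M₂.flow a (-t) p.2)| ≤ ηR * C₀ ^ a * exp (-w * configEnergy p.2)

/-- Relational level bound, *direct form* with slack `ς`: at every level `a ≤ L`, on every coupled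
pair of horizon `σ ≥ ς`, the two families differ by at most `η_R C₀^a e^{-w H}` (the shape in
which the comparison of composites comes out). [cite: BodineauGallagherSaintRaymondInvent2016, §5.3.3 Props. 5.6-5.7, pp. 20–21] -/
def IsRelLevelBddD (G₁ G₂ : GCState d X) (L : ℕ) (ηR C₀ w ς : ℝ) : Prop :=
  ∀ a ≤ L, ∀ (σ : ℝ) (p : Config a d X × Config a d X), p ∈ 𝒞.rel a σ → ς ≤ σ →
    |G₁ a p.1 - G₂ a p.2| ≤ ηR * C₀ ^ a * exp (-w * configEnergy p.2)

variable {𝒞}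

/-- A direct relational bound is in particular a transported one (coupled pairs are stable under
the transports, which preserve the energy). [folklore] -/
theorem isRelLevelBddT_of_D {G₁ G₂ : GCState d X} {L : ℕ} {ηR C₀ w ς : ℝ} (hς : 0 ≤ ς)
    (h : 𝒞.IsRelLevelBddD G₁ G₂ L ηR C₀ w ς) : 𝒞.IsRelLevelBddT G₁ G₂ L ηR C₀ w ς := by
  intro a ha σ p hp t ht
  have htσ : t ∈ Icc δ σ := ⟨ht.1, by linarith [ht.2]⟩
  have hp' := 𝒞.trans a σ p hp t htσ
  have := h a ha (σ - t) _ hp' (by linarith [ht.2])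
  simpa only [M₂.configEnergy_flow] using this

/-- Weakening of a transported relational bound: fewer levels, larger constant, smaller weight,
larger slack. [folklore] -/
theorem IsRelLevelBddT.mono {G₁ G₂ : GCState d X} {L L' : ℕ} {ηR ηR' C₀ w w' ς ς' : ℝ}
    (h : 𝒞.IsRelLevelBddT G₁ G₂ L ηR C₀ w ς) (hL : L' ≤ L) (hη0 : 0 ≤ ηR) (hη : ηR ≤ ηR')
    (hC₀ : 0 ≤ C₀) (hw : w' ≤ w) (hς : ς ≤ ς') : 𝒞.IsRelLevelBddT G₁ G₂ L' ηR' C₀ w' ς' := by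
  intro a ha σ p hp t ht
  have hE : 0 ≤ configEnergy p.2 := configEnergy_nonneg' p.2
  calc |G₁ a (M₁.flow a (-t) p.1) - G₂ a (M₂.flow a (-t) p.2)|
      ≤ ηR * C₀ ^ a * exp (-w * configEnergy p.2) :=
        h a (ha.trans hL) σ p hp t ⟨ht.1, ht.2.trans (by linarith)⟩
    _ ≤ ηR' * C₀ ^ a * exp (-w * configEnergy p.2) := by gcongr
    _ ≤ ηR' * C₀ ^ a * exp (-w' * configEnergy p.2) := by
        have : 0 ≤ ηR' * C₀ ^ a := by
          have := hη0.trans hη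
          positivity
        gcongr ηR' * C₀ ^ a * ?_
        exact exp_le_exp.2 (by nlinarith)

/-- Weakening of a direct relational bound. [folklore] -/
theorem IsRelLevelBddD.mono {G₁ G₂ : GCState d X} {L L' : ℕ} {ηR ηR' C₀ w w' ς ς' : ℝ}
    (h : 𝒞.IsRelLevelBddD G₁ G₂ L ηR C₀ w ς) (hL : L' ≤ L) (hη0 : 0 ≤ ηR) (hη : ηR ≤ ηR')
    (hC₀ : 0 ≤ C₀) (hw : w' ≤ w) (hς : ς ≤ ς') : 𝒞.IsRelLevelBddD G₁ G₂ L' ηR' C₀ w' ς' := by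
  intro a ha σ p hp hσ
  have hE : 0 ≤ configEnergy p.2 := configEnergy_nonneg' p.2
  calc |G₁ a p.1 - G₂ a p.2|
      ≤ ηR * C₀ ^ a * exp (-w * configEnergy p.2) := h a (ha.trans hL) σ p hp (hς.trans hσ)
    _ ≤ ηR' * C₀ ^ a * exp (-w * configEnergy p.2) := by gcongr
    _ ≤ ηR' * C₀ ^ a * exp (-w' * configEnergy p.2) := by
        have : 0 ≤ ηR' * C₀ ^ a := by
          have := hη0.trans hη
          positivity
        gcongr ηR' * C₀ ^ a * ?_
        exact exp_le_exp.2 (by nlinarith)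

/-! ## Energy cut-off: separated terms of truncated data vanish above the cut-off -/

/-- If the collision operators of a model kill, above an energy `E_c`, every density vanishing above
`E_c` (adjoining a particle does not decrease the kinetic energy), then so do all separated Duhamel
terms of data vanishing above `E_c` (the transports preserve the energy): the energy cut-off
`1_{H ≤ E²/2}` of BGSR §5.3.1 imposed on the datum is felt along the whole pseudo-trajectory.
[cite: BodineauGallagherSaintRaymondInvent2016, §5.3.1, p. 19] -/
theorem _root_.Literature.MathematicalPhysics.KineticTheory.HierarchyModel.sepTerm_eq_zero_of_lt
    (M : HierarchyModel d X) {Ec : ℝ}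
    (hV : ∀ (k : ℕ) (g : Config (k + 1) d X → ℝ), (∀ Z, Ec < configEnergy Z → g Z = 0) →
      ∀ Z, Ec < configEnergy Z → M.op k g Z = 0)
    {G : GCState d X} (hG : ∀ (k : ℕ) (Z : Config k d X), Ec < configEnergy Z → G k Z = 0)
    (δ' : ℝ) : ∀ (n k : ℕ) (t : ℝ) (Z : Config k d X), Ec < configEnergy Z → M.sepTerm δ' n k t G Z = 0 := by
  intro n
  induction n with
  | zero =>
    intro k t Z hZ
    rw [sepTerm_zero, M.transport_apply]
    exact hG k _ (by rwa [M.configEnergy_flow])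
  | succ n ih =>
    intro k t Z hZ
    rw [sepTerm_succ]
    refine intervalIntegral.integral_zero_ae (Eventually.of_forall fun τ _ => ?_)
    rw [M.transport_apply]
    exact hV k _ (fun Z' hZ' => ih (k + 1) τ Z' hZ') _ (by rwa [M.configEnergy_flow])

/-- The same for one separated block. [cite: BodineauGallagherSaintRaymondInvent2016, §5.3.1, p. 19] -/
theorem _root_.Literature.MathematicalPhysics.KineticTheory.HierarchyModel.sepBlockOp_eq_zero_of_lt
    (M : HierarchyModel d X) {Ec : ℝ}
    (hV : ∀ (k : ℕ) (g : Config (k + 1) d X → ℝ), (∀ Z, Ec < configEnergy Z → g Z = 0) →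
      ∀ Z, Ec < configEnergy Z → M.op k g Z = 0)
    {G : GCState d X} (hG : ∀ (k : ℕ) (Z : Config k d X), Ec < configEnergy Z → G k Z = 0)
    (δ' : ℝ) (n : ℕ) (h : ℝ) :
    ∀ (k : ℕ) (Z : Config k d X), Ec < configEnergy Z → M.sepBlockOp δ' n h G k Z = 0 := by
  intro k Z hZ
  rw [M.sepBlockOp_apply]
  exact Finset.sum_eq_zero fun j _ => M.sepTerm_eq_zero_of_lt hV hG δ' j k h Z hZ

/-- The same for composites of separated blocks. [cite: BodineauGallagherSaintRaymondInvent2016, §5.3.1, p. 19] -/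
theorem _root_.Literature.MathematicalPhysics.KineticTheory.HierarchyModel.sepBlockComp_eq_zero_of_lt
    (M : HierarchyModel d X) {Ec : ℝ}
    (hV : ∀ (k : ℕ) (g : Config (k + 1) d X → ℝ), (∀ Z, Ec < configEnergy Z → g Z = 0) →
      ∀ Z, Ec < configEnergy Z → M.op k g Z = 0)
    (δ' : ℝ) (nseq : ℕ → ℕ) (h : ℝ) : ∀ (i : ℕ) {G : GCState d X},
      (∀ (k : ℕ) (Z : Config k d X), Ec < configEnergy Z → G k Z = 0) →
      ∀ (k : ℕ) (Z : Config k d X), Ec < configEnergy Z → M.sepBlockComp δ' nseq h i G k Z = 0 := by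
  intro i
  induction i with
  | zero => intro G hG k Z hZ; simpa using hG k Z hZ
  | succ i ih =>
    intro G hG k Z hZ
    rw [M.sepBlockComp_succ]
    exact ih (M.sepBlockOp_eq_zero_of_lt hV hG δ' (nseq i) h) k Z hZ

omit [MeasurableSpace X] in
/-- The energy cut-off of any family vanishes above the cut-off `E²/2`. [folklore] -/
theorem _root_.Literature.MathematicalPhysics.KineticTheory.energyTruncate_eq_zero_of_lt (E : ℝ)
    (G : GCState d X) (k : ℕ) (Z : Config k d X) (hZ : E ^ 2 / 2 < configEnergy Z) :
    energyTruncate E G k Z = 0 := by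
  rw [energyTruncate_apply, if_neg (not_le.2 hZ)]

/-! ## The relational chain estimate -/

/-- Monotonicity of the chain majorant in the cost. [folklore] -/
theorem chainBound_mono {K Λ Λ' t : ℝ} {n : ℕ} (hK : 0 ≤ K) (hΛ : 0 ≤ Λ) (hΛ' : Λ ≤ Λ') (ht : 0 ≤ t)
    (e : ℝ) : K * Λ ^ n * t ^ n / n ! * exp e ≤ K * Λ' ^ n * t ^ n / n ! * exp e := by
  have : Λ ^ n ≤ Λ' ^ n := pow_le_pow_left₀ hΛ hΛ' n
  gcongr

/-- **The relational chain estimate** (BGSR Prop. 5.3 with the mechanism of Props. 5.6–5.7, for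
one elementary term of the separated expansions of two coupled models). Fix a weight floor `λₘ`,
a decrement `η`, at most `k_max + 1` particles, a cost `Λ` dominating the chain costs of both
models and `Λ_rel`, a per-collision error `E_rel ≤ θ Λ`, models killing densities above the energy
cut-off, nice data `G₁, G₂` vanishing above the cut-off, and a slack `ς ≥ 0`. If at the top level
`m = s + n` both data obey `|G^{(m)}| ≤ K e^{-(λ₀ + nη) H}` and are `η_r e^{-(λ₀+nη)H}`-close at the
transports (by `t' ∈ [δ, σ' - ς]`) of all coupled pairs of horizon `σ'`, then on every coupled
level-`s` pair `(Z, Y)` of horizon `σ` and for `t ∈ [δ, σ - ς]`,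
`|Q^{δ,1}_{s,s+n}(t) G₁ (Z) - Q^{δ,2}_{s,s+n}(t) G₂ (Y)| ≤ (η_r + n θ K) Λⁿ tⁿ/n! e^{-λ₀ H(Y)}`.
Induction on `n`: at order `n + 1` the two terms are the integrals over the collision time
`τ ∈ [δ, t - δ]` of the two collision operators applied to the order-`n` terms at level `s + 1`
(time `τ`, a priori bound `K Λⁿ τⁿ/n!` by the chain estimate of N5d₂, `(η_r + nθK) Λⁿτⁿ/n!`-close on
the coupled pairs of horizon `σ - (t - τ)` by the induction hypothesis) read at the pair transported
by `s = t - τ ∈ [δ, σ]`; for a.e. `τ` the one-step hypothesis bounds the integrand by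
`(Λ (η_r + nθK) + θ Λ K) Λⁿ τⁿ/n! e^{-λ₀ H(Y)}`, which integrates to the claim.
[cite: BodineauGallagherSaintRaymondInvent2016, §5.2.2 Prop. 5.3 and §5.3.3 Props. 5.6-5.7, pp. 18–21] -/
theorem abs_sepTerm_sub_sepTerm_le (hδ : 0 ≤ δ) {Ec bm η : ℝ} (hbm : 0 < bm) (hη : 0 < η)
    {kmax : ℕ} {Λrel Erel Λ θ : ℝ} (hstep : 𝒞.RelStep Ec bm η kmax Λrel Erel)
    (hV₁ : ∀ (k : ℕ) (g : Config (k + 1) d X → ℝ), (∀ Z, Ec < configEnergy Z → g Z = 0) →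
      ∀ Z, Ec < configEnergy Z → M₁.op k g Z = 0)
    (hV₂ : ∀ (k : ℕ) (g : Config (k + 1) d X → ℝ), (∀ Z, Ec < configEnergy Z → g Z = 0) →
      ∀ Z, Ec < configEnergy Z → M₂.op k g Z = 0)
    (hθ : 0 ≤ θ) (hΛ₁ : M₁.chainCost bm η kmax ≤ Λ)
    (hΛ₂ : M₂.chainCost bm η kmax ≤ Λ) (hΛr : Λrel ≤ Λ) (hEθ : Erel ≤ θ * Λ)
    {G₁ G₂ : GCState d X} (hG₁ : ∀ k, IsNice (G₁ k)) (hG₂ : ∀ k, IsNice (G₂ k))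
    (hGv₁ : ∀ (k : ℕ) (Z : Config k d X), Ec < configEnergy Z → G₁ k Z = 0)
    (hGv₂ : ∀ (k : ℕ) (Z : Config k d X), Ec < configEnergy Z → G₂ k Z = 0) {ς : ℝ} (hς : 0 ≤ ς) :
    ∀ (n s m : ℕ), m = s + n → m ≤ kmax + 1 → ∀ {b₀ : ℝ}, bm ≤ b₀ → ∀ {K : ℝ}, 0 ≤ K →
      ∀ {ηr : ℝ}, 0 ≤ ηr →
      (∀ Z : Config m d X, |G₁ m Z| ≤ K * exp (-(b₀ + n * η) * configEnergy Z)) →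
      (∀ Z : Config m d X, |G₂ m Z| ≤ K * exp (-(b₀ + n * η) * configEnergy Z)) →
      (∀ (σ' : ℝ) (q : Config m d X × Config m d X), q ∈ 𝒞.rel m σ' → ∀ t' ∈ Icc δ (σ' - ς),
        |G₁ m (M₁.flow m (-t') q.1) - G₂ m (M₂.flow m (-t') q.2)| ≤
          ηr * exp (-(b₀ + n * η) * configEnergy q.2)) →
      ∀ (σ : ℝ) (p : Config s d X × Config s d X), p ∈ 𝒞.rel s σ → ∀ {t : ℝ}, t ∈ Icc δ (σ - ς) →
        |M₁.sepTerm δ n s t G₁ p.1 - M₂.sepTerm δ n s t G₂ p.2| ≤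
          (ηr + n * (θ * K)) * Λ ^ n * t ^ n / n ! * exp (-b₀ * configEnergy p.2) := by
  have hΛ0 : 0 ≤ Λ := (M₁.chainCost_nonneg bm η kmax).trans hΛ₁
  intro n
  induction n with
  | zero =>
    intro s m hm _ b₀ _ K _ ηr _ _ _ hrel σ p hp t ht
    obtain rfl : m = s := by simpa using hm
    rw [sepTerm_zero, sepTerm_zero, M₁.transport_apply, M₂.transport_apply]
    simpa using hrel σ p hp t ht
  | succ n ih =>
    intro s m hm hmk b₀ hb₀ K hK ηr hηr hin₁ hin₂ hrel σ p hp t ht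
    have hs : s ≤ kmax := by omega
    have ht0 : 0 ≤ t := hδ.trans ht.1
    have htσ : t ≤ σ := by linarith [ht.2]
    -- the data bounds at level `m`, final weight `b₀ + η`
    have hin₁' : ∀ Z : Config m d X, |G₁ m Z| ≤ K * exp (-((b₀ + η) + n * η) * configEnergy Z) := by
      intro Z'; convert hin₁ Z' using 3; push_cast; ring
    have hin₂' : ∀ Z : Config m d X, |G₂ m Z| ≤ K * exp (-((b₀ + η) + n * η) * configEnergy Z) := by
      intro Z'; convert hin₂ Z' using 3; push_cast; ring
    have hrel' : ∀ (σ' : ℝ) (q : Config m d X × Config m d X), q ∈ 𝒞.rel m σ' →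
        ∀ t' ∈ Icc δ (σ' - ς), |G₁ m (M₁.flow m (-t') q.1) - G₂ m (M₂.flow m (-t') q.2)| ≤
          ηr * exp (-((b₀ + η) + n * η) * configEnergy q.2) := by
      intro σ' q hq t' ht'; convert hrel σ' q hq t' ht' using 3; push_cast; ring
    have hb₀' : bm ≤ b₀ + η := by linarith
    -- induction hypothesis at level `s + 1`: the relational bound of the inner terms
    have hIH := @ih (s + 1) m (by omega) hmk (b₀ + η) hb₀' K hK ηr hηr hin₁' hin₂' hrel'
    -- a priori bounds of the inner terms (chain estimate of N5d₂ for each model)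
    have hap₁ : ∀ {τ : ℝ}, 0 ≤ τ → ∀ Z' : Config (s + 1) d X, |M₁.sepTerm δ n (s + 1) τ G₁ Z'| ≤
        K * Λ ^ n * τ ^ n / n ! * exp (-(b₀ + η) * configEnergy Z') := by
      intro τ hτ Z'
      refine (M₁.abs_sepTerm_le_weighted hδ hbm hη kmax G₁ n (s + 1) m (by omega) hmk hb₀' hK hin₁'
        hτ Z').trans ?_
      exact chainBound_mono hK (M₁.chainCost_nonneg bm η kmax) hΛ₁ hτ _
    have hap₂ : ∀ {τ : ℝ}, 0 ≤ τ → ∀ Z' : Config (s + 1) d X, |M₂.sepTerm δ n (s + 1) τ G₂ Z'| ≤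
        K * Λ ^ n * τ ^ n / n ! * exp (-(b₀ + η) * configEnergy Z') := by
      intro τ hτ Z'
      refine (M₂.abs_sepTerm_le_weighted hδ hbm hη kmax G₂ n (s + 1) m (by omega) hmk hb₀' hK hin₂'
        hτ Z').trans ?_
      exact chainBound_mono hK (M₂.chainCost_nonneg bm η kmax) hΛ₂ hτ _
    -- the separated time integrals
    rw [sepTerm_succ, sepTerm_succ]
    rcases lt_or_ge t (2 * δ) with hlt | hge
    · rw [max_eq_left (by linarith), intervalIntegral.integral_same, intervalIntegral.integral_same,
        sub_zero, abs_zero]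
      positivity
    have hm1 : δ ≤ t - δ := by linarith
    have hm2 : t - δ ≤ t := by linarith
    rw [max_eq_right hm1]
    -- integrability of both integrands on `[δ, t - δ] ⊆ [0, t]`
    have hsub : uIcc δ (t - δ) ⊆ uIcc 0 t := by
      rw [uIcc_of_le hm1, uIcc_of_le ht0]
      exact Icc_subset_Icc hδ hm2
    have hT : t ∈ Icc 0 t := ⟨ht0, le_rfl⟩
    have hI₁ := (intervalIntegrable_duhamelStep M₁ (M₁.isNiceT_sepTerm hδ hG₁ (T := t) n (s + 1)) hT
      p.1).mono_set hsub
    have hI₂ := (intervalIntegrable_duhamelStep M₂ (M₂.isNiceT_sepTerm hδ hG₂ (T := t) n (s + 1)) hT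
      p.2).mono_set hsub
    rw [← intervalIntegral.integral_sub hI₁ hI₂]
    -- the pointwise bound, for a.e. collision time `τ`
    set g : ℝ → ℝ := fun τ => (ηr + (n + 1 : ℕ) * (θ * K)) * Λ ^ (n + 1) * τ ^ n / n ! *
      exp (-b₀ * configEnergy p.2) with hg
    have hstep' := hstep s hs σ p hp
    have hae : ∀ᵐ τ : ℝ, τ ∈ Ioc δ (t - δ) →
        ‖M₁.transport s (t - τ) (M₁.op s (M₁.sepTerm δ n (s + 1) τ G₁)) p.1 -
          M₂.transport s (t - τ) (M₂.op s (M₂.sepTerm δ n (s + 1) τ G₂)) p.2‖ ≤ g τ := by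
      have hqmp := (Measure.measurePreserving_sub_left (volume : Measure ℝ) t).quasiMeasurePreserving
      filter_upwards [hqmp.ae hstep'] with τ hτ hτI
      have hτ0 : 0 ≤ τ := hδ.trans hτI.1.le
      have hsI : t - τ ∈ Icc δ σ := ⟨by linarith [hτI.2], by linarith [hτI.1]⟩
      have hKτ : 0 ≤ K * Λ ^ n * τ ^ n / n ! := by positivity
      have hητ : 0 ≤ (ηr + n * (θ * K)) * Λ ^ n * τ ^ n / n ! := by positivity
      -- the relational bound of the inner terms on the pairs of horizon `σ - (t - τ)`
      have hrelτ : ∀ q ∈ 𝒞.rel (s + 1) (σ - (t - τ)),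
          |M₁.sepTerm δ n (s + 1) τ G₁ q.1 - M₂.sepTerm δ n (s + 1) τ G₂ q.2| ≤
            (ηr + n * (θ * K)) * Λ ^ n * τ ^ n / n ! * exp (-(b₀ + η) * configEnergy q.2) := by
        intro q hq
        exact hIH (σ - (t - τ)) q hq ⟨hτI.1.le, by linarith [ht.2]⟩
      have key := hτ hsI (fun Z => M₁.sepTerm δ n (s + 1) τ G₁ Z) (fun Z => M₂.sepTerm δ n (s + 1) τ G₂ Z)
        (K * Λ ^ n * τ ^ n / n !) ((ηr + n * (θ * K)) * Λ ^ n * τ ^ n / n !) b₀ hb₀ hKτ hητ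
        ((M₁.isNiceT_sepTerm hδ hG₁ (T := t) n (s + 1)).isNice ⟨hτ0, hτI.2.trans hm2⟩).1
        ((M₂.isNiceT_sepTerm hδ hG₂ (T := t) n (s + 1)).isNice ⟨hτ0, hτI.2.trans hm2⟩).1
        (hap₁ hτ0) (hap₂ hτ0)
        (fun Z hZ => M₁.sepTerm_eq_zero_of_lt hV₁ hGv₁ δ n (s + 1) τ Z hZ)
        (fun Z hZ => M₂.sepTerm_eq_zero_of_lt hV₂ hGv₂ δ n (s + 1) τ Z hZ) hrelτ
      rw [Real.norm_eq_abs, M₁.transport_apply, M₂.transport_apply, M₂.configEnergy_flow] at *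
      refine key.trans ?_
      have hE := configEnergy_nonneg' p.2
      have hexp : 0 ≤ exp (-b₀ * configEnergy p.2) := (exp_pos _).le
      -- `Λ_rel (η_r + nθK) + E_rel K ≤ Λ (η_r + (n+1) θ K)`
      have h1 : Λrel * ((ηr + n * (θ * K)) * Λ ^ n * τ ^ n / n !) ≤
          Λ * ((ηr + n * (θ * K)) * Λ ^ n * τ ^ n / n !) := mul_le_mul_of_nonneg_right hΛr hητ
      have h2 : Erel * (K * Λ ^ n * τ ^ n / n !) ≤ θ * Λ * (K * Λ ^ n * τ ^ n / n !) :=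
        mul_le_mul_of_nonneg_right hEθ hKτ
      calc (Λrel * ((ηr + n * (θ * K)) * Λ ^ n * τ ^ n / n !) + Erel * (K * Λ ^ n * τ ^ n / n !)) *
            exp (-b₀ * configEnergy p.2)
          ≤ (Λ * ((ηr + n * (θ * K)) * Λ ^ n * τ ^ n / n !) + θ * Λ * (K * Λ ^ n * τ ^ n / n !)) *
            exp (-b₀ * configEnergy p.2) := by gcongr
        _ = g τ := by rw [hg]; push_cast; ring
    -- integrate the bound
    have hcont : Continuous g := by rw [hg]; fun_prop
    have hle := intervalIntegral.norm_integral_le_of_norm_le hm1 hae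
      (hcont.intervalIntegrable (μ := volume) δ (t - δ))
    rw [Real.norm_eq_abs] at hle
    refine hle.trans ?_
    have hnn : 0 ≤ᵐ[volume.restrict (Ioc 0 t)] g := by
      refine (ae_restrict_mem measurableSet_Ioc).mono fun τ hτ => ?_
      have := hτ.1.le
      rw [hg]; positivity
    refine (intervalIntegral.integral_mono_interval hδ hm1 hm2 hnn
      (hcont.intervalIntegrable (μ := volume) 0 t)).trans (le_of_eq ?_)
    have hfun : g = fun τ : ℝ => ((ηr + (n + 1 : ℕ) * (θ * K)) * Λ ^ (n + 1) / n ! *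
        exp (-b₀ * configEnergy p.2)) * τ ^ n := by
      funext τ; rw [hg]; ring
    rw [hfun, intervalIntegral.integral_const_mul, integral_pow, zero_pow (Nat.succ_ne_zero n),
      sub_zero, Nat.factorial_succ]
    push_cast
    field_simp

/-! ## One separated block -/

/-- The block factor `∑_{j<n} xʲ/j!` is monotone in `x ≥ 0`. [folklore] -/
theorem blockFactor_mono {x y : ℝ} (hx : 0 ≤ x) (hxy : x ≤ y) (n : ℕ) :
    ∑ j ∈ Finset.range n, x ^ j / j ! ≤ ∑ j ∈ Finset.range n, y ^ j / j ! :=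
  Finset.sum_le_sum fun j _ => by
    have : x ^ j ≤ y ^ j := pow_le_pow_left₀ hx hxy j
    gcongr

/-- **One separated block propagates relational level bounds** (BGSR Props. 5.6–5.7 for one
block of the pruned expansions): with the a priori level bound `R C₀^a e^{-wH}` of both data at
the levels `a ≤ L_top`, their transported relational bound `η_R C₀^a e^{-wH}` with slack `ς`, a
budget `β_b` spent as `β_b/n` on each of the `< n` collision operators, a cost `Λ` dominating both
chain costs and `Λ_rel`, and a per-collision error `E_rel ≤ θ Λ`, the two separated blocks are,
at the levels `a ≤ L_low` (`L_low + n ≤ L_top + 1`) and directly on the coupled pairs of horizon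
`σ ≥ ς + h`, `(η_R + n θ R) E_b C₀^a e^{-(w-β_b)H}`-close, `E_b = ∑_{j<n} (C₀ Λ h)^j/j!` (the
relational chain estimate for each of the `< n` terms: the term with `j` collisions contributes
`(η_R + j θ R) C₀^{a+j} Λʲ hʲ/j!`). Printed: the error is paid "`J_K - 1 ≤ A^{K+1}`" times and
multiplied by the continuity estimate `(Ct)^{A^{K+1}}`.
[cite: BodineauGallagherSaintRaymondInvent2016, §5.3.3 Props. 5.6-5.7, pp. 20–21] -/
theorem isRelLevelBddD_sepBlockOp (hδ : 0 ≤ δ) {Ec bm βb : ℝ} (hbm : 0 < bm) (hβb : 0 < βb)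
    {Ltop Llow n : ℕ} (hn : 1 ≤ n) (hL : Llow + n ≤ Ltop + 1) {Λrel Erel Λ θ : ℝ}
    (hstep : 𝒞.RelStep Ec bm (βb / n) Ltop Λrel Erel)
    (hV₁ : ∀ (k : ℕ) (g : Config (k + 1) d X → ℝ), (∀ Z, Ec < configEnergy Z → g Z = 0) →
      ∀ Z, Ec < configEnergy Z → M₁.op k g Z = 0)
    (hV₂ : ∀ (k : ℕ) (g : Config (k + 1) d X → ℝ), (∀ Z, Ec < configEnergy Z → g Z = 0) →
      ∀ Z, Ec < configEnergy Z → M₂.op k g Z = 0)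
    (hθ : 0 ≤ θ) (hΛ₁ : M₁.chainCost bm (βb / n) Ltop ≤ Λ) (hΛ₂ : M₂.chainCost bm (βb / n) Ltop ≤ Λ)
    (hΛr : Λrel ≤ Λ) (hEθ : Erel ≤ θ * Λ)
    {G₁ G₂ : GCState d X} (hG₁ : ∀ k, IsNice (G₁ k)) (hG₂ : ∀ k, IsNice (G₂ k))
    (hGv₁ : ∀ (k : ℕ) (Z : Config k d X), Ec < configEnergy Z → G₁ k Z = 0)
    (hGv₂ : ∀ (k : ℕ) (Z : Config k d X), Ec < configEnergy Z → G₂ k Z = 0)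
    {R C₀ w ηR ς : ℝ} (hR : 0 ≤ R) (hC₀ : 1 ≤ C₀) (hw : bm + βb ≤ w) (hηR : 0 ≤ ηR) (hς : 0 ≤ ς)
    (hb₁ : IsLevelBdd G₁ Ltop R C₀ w) (hb₂ : IsLevelBdd G₂ Ltop R C₀ w)
    (hrel : 𝒞.IsRelLevelBddT G₁ G₂ Ltop ηR C₀ w ς) {h : ℝ} (hh : δ ≤ h) :
    𝒞.IsRelLevelBddD (M₁.sepBlockOp δ n h G₁) (M₂.sepBlockOp δ n h G₂) Llow
      ((ηR + n * (θ * R)) * ∑ j ∈ Finset.range n, (C₀ * Λ * h) ^ j / j !) C₀ (w - βb) (ς + h) := by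
  intro a ha σ p hp hσ
  have hC₀0 : 0 ≤ C₀ := zero_le_one.trans hC₀
  have hn0 : (0 : ℝ) < n := by exact_mod_cast hn
  have hδw : 0 < βb / n := div_pos hβb hn0
  have hb₀ : bm ≤ w - βb := by linarith
  have hΛ0 : 0 ≤ Λ := (M₁.chainCost_nonneg bm (βb / n) Ltop).trans hΛ₁
  have hh0 : 0 ≤ h := hδ.trans hh
  have hhI : h ∈ Icc δ (σ - ς) := ⟨hh, by linarith⟩
  rw [M₁.sepBlockOp_apply, M₂.sepBlockOp_apply, ← Finset.sum_sub_distrib]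
  refine (Finset.abs_sum_le_sum_abs _ _).trans ?_
  rw [Finset.mul_sum, Finset.sum_mul, Finset.sum_mul]
  refine Finset.sum_le_sum fun j hj => ?_
  have hjn : j < n := Finset.mem_range.1 hj
  have haj : a + j ≤ Ltop + 1 := by omega
  have hK : 0 ≤ R * C₀ ^ (a + j) := by positivity
  have hηK : 0 ≤ ηR * C₀ ^ (a + j) := by positivity
  -- weakening of the weight `w` to `(w - β_b) + j β_b/n ≤ w`
  have hwle : (w - βb) + j * (βb / n) ≤ w := by
    have hj' : (j : ℝ) ≤ n := by exact_mod_cast hjn.le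
    have : (j : ℝ) * (βb / n) ≤ βb := by
      rw [mul_div_assoc', div_le_iff₀ hn0]
      nlinarith
    linarith
  have hweak : ∀ {m : ℕ} (Z' : Config m d X) {c : ℝ}, 0 ≤ c →
      c * exp (-w * configEnergy Z') ≤ c * exp (-((w - βb) + j * (βb / n)) * configEnergy Z') := by
    intro m Z' c hc
    have hE : 0 ≤ configEnergy Z' := configEnergy_nonneg' Z'
    gcongr c * ?_
    exact exp_le_exp.2 (by nlinarith)
  have hin₁ : ∀ Z' : Config (a + j) d X, |G₁ (a + j) Z'| ≤
      R * C₀ ^ (a + j) * exp (-((w - βb) + j * (βb / n)) * configEnergy Z') := fun Z' =>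
    (hb₁ (a + j) (by omega) Z').trans (hweak Z' hK)
  have hin₂ : ∀ Z' : Config (a + j) d X, |G₂ (a + j) Z'| ≤
      R * C₀ ^ (a + j) * exp (-((w - βb) + j * (βb / n)) * configEnergy Z') := fun Z' =>
    (hb₂ (a + j) (by omega) Z').trans (hweak Z' hK)
  have hrel' : ∀ (σ' : ℝ) (q : Config (a + j) d X × Config (a + j) d X), q ∈ 𝒞.rel (a + j) σ' →
      ∀ t' ∈ Icc δ (σ' - ς), |G₁ (a + j) (M₁.flow (a + j) (-t') q.1) - G₂ (a + j) (M₂.flow (a + j) (-t') q.2)| ≤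
        ηR * C₀ ^ (a + j) * exp (-((w - βb) + j * (βb / n)) * configEnergy q.2) :=
    fun σ' q hq t' ht' => (hrel (a + j) (by omega) σ' q hq t' ht').trans (hweak q.2 hηK)
  have hest := 𝒞.abs_sepTerm_sub_sepTerm_le hδ hbm hδw hstep hV₁ hV₂ hθ hΛ₁ hΛ₂ hΛr hEθ hG₁ hG₂ hGv₁
    hGv₂ hς j a (a + j) rfl haj hb₀ hK hηK hin₁ hin₂ hrel' σ p hp hhI
  refine hest.trans ?_
  have hexp : 0 ≤ exp (-(w - βb) * configEnergy p.2) := (exp_pos _).le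
  have heq : (ηR * C₀ ^ (a + j) + j * (θ * (R * C₀ ^ (a + j)))) * Λ ^ j * h ^ j / j ! *
      exp (-(w - βb) * configEnergy p.2) =
      (ηR + j * (θ * R)) * (C₀ ^ a * ((C₀ * Λ * h) ^ j / j !) * exp (-(w - βb) * configEnergy p.2)) := by
    rw [pow_add, mul_pow, mul_pow]; ring
  rw [heq]
  have hj' : (j : ℝ) ≤ n := by exact_mod_cast hjn.le
  have hθR : 0 ≤ θ * R := mul_nonneg hθ hR
  have h1 : ηR + j * (θ * R) ≤ ηR + n * (θ * R) := by nlinarith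
  have h2 : 0 ≤ C₀ ^ a * ((C₀ * Λ * h) ^ j / j !) * exp (-(w - βb) * configEnergy p.2) := by positivity
  calc (ηR + j * (θ * R)) * (C₀ ^ a * ((C₀ * Λ * h) ^ j / j !) * exp (-(w - βb) * configEnergy p.2))
      ≤ (ηR + n * (θ * R)) * (C₀ ^ a * ((C₀ * Λ * h) ^ j / j !) * exp (-(w - βb) * configEnergy p.2)) :=
        mul_le_mul_of_nonneg_right h1 h2
    _ = (ηR + n * (θ * R)) * ((C₀ * Λ * h) ^ j / j !) * C₀ ^ a * exp (-(w - βb) * configEnergy p.2) := by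
        ring

/-! ## Composition of the separated blocks -/

/-- **Relational level bounds through the composite of separated blocks** (BGSR Props. 5.6–5.7
summed over the blocks of the pruned expansion): for thresholds `n_{b+1} = A^{b+1}`, budgets
`β_b`, costs `Λ_b` dominating the chain costs of both models and `Λ_rel,b`, errors
`E_rel,b ≤ θ_b Λ_b`, nice data vanishing above the energy cut-off with the a priori level bound
`R C₀^a e^{-wH}` and the transported relational bound `η_R C₀^a e^{-wH}` (slack `ς`) at all levels
`a ≤ L_i = pruneLevel A i`, the composites of `i` separated blocks satisfy the transported
relational bound at level `1` with constant `(η_R + R ∑_{b<i} n_b θ_b) ∏_{b<i} E_b`, weight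
`w - ∑_{b<i} β_b` and slack `ς + i h`, and, for `i ≥ 1`, the direct one (induction on `i` with
`isRelLevelBddD_sepBlockOp`, `isRelLevelBddT_of_D` and N5d₃'s `isLevelBdd_sepBlockOp`: the innermost
block maps `(η_R, R) ↦ ((η_R + n θ R) E, R E)`).
[cite: BodineauGallagherSaintRaymondInvent2016, §5.3.3 Props. 5.6-5.7, pp. 20–21] -/
theorem isRelLevelBddT_sepBlockComp (hδ : 0 ≤ δ) {A : ℕ} (hA : 1 ≤ A) {Ec bm C₀ : ℝ} (hbm : 0 < bm)
    (hC₀ : 1 ≤ C₀) (βs Λs θs Λrels Erels : ℕ → ℝ) (hβs : ∀ b, 0 < βs b) (hθs : ∀ b, 0 ≤ θs b)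
    (hstep : ∀ b, 𝒞.RelStep Ec bm (βs b / pruneSeq A b) (pruneLevel A (b + 1)) (Λrels b) (Erels b))
    (hV₁ : ∀ (k : ℕ) (g : Config (k + 1) d X → ℝ), (∀ Z, Ec < configEnergy Z → g Z = 0) →
      ∀ Z, Ec < configEnergy Z → M₁.op k g Z = 0)
    (hV₂ : ∀ (k : ℕ) (g : Config (k + 1) d X → ℝ), (∀ Z, Ec < configEnergy Z → g Z = 0) →
      ∀ Z, Ec < configEnergy Z → M₂.op k g Z = 0)
    (hΛ₁ : ∀ b, M₁.chainCost bm (βs b / pruneSeq A b) (pruneLevel A (b + 1)) ≤ Λs b)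
    (hΛ₂ : ∀ b, M₂.chainCost bm (βs b / pruneSeq A b) (pruneLevel A (b + 1)) ≤ Λs b)
    (hΛr : ∀ b, Λrels b ≤ Λs b) (hEθ : ∀ b, Erels b ≤ θs b * Λs b) {h : ℝ} (hh : δ ≤ h) :
    ∀ (i : ℕ) (G₁ G₂ : GCState d X) (R ηR w ς : ℝ), 0 ≤ R → 0 ≤ ηR → 0 ≤ ς →
      bm + ∑ b ∈ Finset.range i, βs b ≤ w →
      (∀ k, IsNice (G₁ k)) → (∀ k, IsNice (G₂ k)) →
      (∀ (k : ℕ) (Z : Config k d X), Ec < configEnergy Z → G₁ k Z = 0) →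
      (∀ (k : ℕ) (Z : Config k d X), Ec < configEnergy Z → G₂ k Z = 0) →
      IsLevelBdd G₁ (pruneLevel A i) R C₀ w → IsLevelBdd G₂ (pruneLevel A i) R C₀ w →
      𝒞.IsRelLevelBddT G₁ G₂ (pruneLevel A i) ηR C₀ w ς →
      𝒞.IsRelLevelBddT (M₁.sepBlockComp δ (pruneSeq A) h i G₁) (M₂.sepBlockComp δ (pruneSeq A) h i G₂) 1
          ((ηR + R * ∑ b ∈ Finset.range i, (pruneSeq A b : ℝ) * θs b) *
            ∏ b ∈ Finset.range i, ∑ j ∈ Finset.range (pruneSeq A b), (C₀ * Λs b * h) ^ j / j !)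
          C₀ (w - ∑ b ∈ Finset.range i, βs b) (ς + i * h) ∧
      (1 ≤ i → 𝒞.IsRelLevelBddD (M₁.sepBlockComp δ (pruneSeq A) h i G₁)
          (M₂.sepBlockComp δ (pruneSeq A) h i G₂) 1
          ((ηR + R * ∑ b ∈ Finset.range i, (pruneSeq A b : ℝ) * θs b) *
            ∏ b ∈ Finset.range i, ∑ j ∈ Finset.range (pruneSeq A b), (C₀ * Λs b * h) ^ j / j !)
          C₀ (w - ∑ b ∈ Finset.range i, βs b) (ς + i * h)) := by
  have hC₀0 : 0 ≤ C₀ := zero_le_one.trans hC₀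
  have hh0 : 0 ≤ h := hδ.trans hh
  have hΛ0 : ∀ b, 0 ≤ Λs b := fun b => (M₁.chainCost_nonneg _ _ _).trans (hΛ₁ b)
  -- the block factors
  set E : ℕ → ℝ := fun b => ∑ j ∈ Finset.range (pruneSeq A b), (C₀ * Λs b * h) ^ j / j ! with hE
  have hE1 : ∀ b, 1 ≤ E b := fun b =>
    one_le_blockFactor (by have := hΛ0 b; positivity) (one_le_pruneSeq hA b)
  have hE0 : ∀ b, 0 ≤ E b := fun b => zero_le_one.trans (hE1 b)
  intro i
  induction i with
  | zero =>
    intro G₁ G₂ R ηR w ς hR hηR hς hw hn₁ hn₂ hv₁ hv₂ hb₁ hb₂ hrel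
    refine ⟨?_, fun h => absurd h (by norm_num)⟩
    simpa [pruneLevel_zero] using hrel
  | succ i ih =>
    intro G₁ G₂ R ηR w ς hR hηR hς hw hn₁ hn₂ hv₁ hv₂ hb₁ hb₂ hrel
    rw [Finset.sum_range_succ] at hw
    have hsum0 : 0 ≤ ∑ b ∈ Finset.range i, βs b := Finset.sum_nonneg fun b _ => (hβs b).le
    have hwb : bm + βs i ≤ w := by linarith
    have hL : pruneLevel A i + pruneSeq A i ≤ pruneLevel A (i + 1) + 1 := (pruneLevel_succ hA i).symm.le
    have hn : 1 ≤ pruneSeq A i := one_le_pruneSeq hA i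
    -- the innermost block `i`: the new data
    set G₁' := M₁.sepBlockOp δ (pruneSeq A i) h G₁ with hG₁'
    set G₂' := M₂.sepBlockOp δ (pruneSeq A i) h G₂ with hG₂'
    have hn₁' : ∀ k, IsNice (G₁' k) := fun k => isNice_sepBlockOp hδ hn₁ _ hh0 k
    have hn₂' : ∀ k, IsNice (G₂' k) := fun k => isNice_sepBlockOp hδ hn₂ _ hh0 k
    have hv₁' : ∀ (k : ℕ) (Z : Config k d X), Ec < configEnergy Z → G₁' k Z = 0 :=
      M₁.sepBlockOp_eq_zero_of_lt hV₁ hv₁ δ _ h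
    have hv₂' : ∀ (k : ℕ) (Z : Config k d X), Ec < configEnergy Z → G₂' k Z = 0 :=
      M₂.sepBlockOp_eq_zero_of_lt hV₂ hv₂ δ _ h
    -- a priori level bounds of the new data, with the common block factor `E i`
    have hRE : 0 ≤ R * E i := mul_nonneg hR (hE0 i)
    have hb₁' : IsLevelBdd G₁' (pruneLevel A i) (R * E i) C₀ (w - βs i) := by
      have h0 := isLevelBdd_sepBlockOp (M := M₁) hδ hR hC₀ hbm (hβs i) hwb hn hL hb₁ hh0
      refine h0.mono le_rfl ?_ ?_ hC₀0 le_rfl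
      · refine mul_nonneg hR (Finset.sum_nonneg fun j _ => ?_)
        have := M₁.chainCost_nonneg bm (βs i / pruneSeq A i) (pruneLevel A (i + 1))
        positivity
      · refine mul_le_mul_of_nonneg_left (blockFactor_mono ?_ ?_ _) hR
        · have := M₁.chainCost_nonneg bm (βs i / pruneSeq A i) (pruneLevel A (i + 1)); positivity
        · have := hΛ₁ i; gcongr
    have hb₂' : IsLevelBdd G₂' (pruneLevel A i) (R * E i) C₀ (w - βs i) := by
      have h0 := isLevelBdd_sepBlockOp (M := M₂) hδ hR hC₀ hbm (hβs i) hwb hn hL hb₂ hh0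
      refine h0.mono le_rfl ?_ ?_ hC₀0 le_rfl
      · refine mul_nonneg hR (Finset.sum_nonneg fun j _ => ?_)
        have := M₂.chainCost_nonneg bm (βs i / pruneSeq A i) (pruneLevel A (i + 1))
        positivity
      · refine mul_le_mul_of_nonneg_left (blockFactor_mono ?_ ?_ _) hR
        · have := M₂.chainCost_nonneg bm (βs i / pruneSeq A i) (pruneLevel A (i + 1)); positivity
        · have := hΛ₂ i; gcongr
    -- the relational bound of the new data (direct, hence transported)
    have hD : 𝒞.IsRelLevelBddD G₁' G₂' (pruneLevel A i)
        ((ηR + pruneSeq A i * (θs i * R)) * E i) C₀ (w - βs i) (ς + h) :=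
      𝒞.isRelLevelBddD_sepBlockOp hδ hbm (hβs i) hn hL (hstep i) hV₁ hV₂ (hθs i) (hΛ₁ i) (hΛ₂ i)
        (hΛr i) (hEθ i) hn₁ hn₂ hv₁ hv₂ hR hC₀ hwb hηR hς hb₁ hb₂ hrel hh
    have hς' : 0 ≤ ς + h := by linarith
    have hT := isRelLevelBddT_of_D hς' hD
    have hηR' : 0 ≤ (ηR + pruneSeq A i * (θs i * R)) * E i :=
      mul_nonneg (by have := hθs i; positivity) (hE0 i)
    have hw' : bm + ∑ b ∈ Finset.range i, βs b ≤ w - βs i := by linarith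
    obtain ⟨ihT, ihD⟩ := ih G₁' G₂' (R * E i) _ (w - βs i) (ς + h) hRE hηR' hς' hw' hn₁' hn₂' hv₁' hv₂'
      hb₁' hb₂' hT
    -- bookkeeping of the constants
    have hηeq : ((ηR + pruneSeq A i * (θs i * R)) * E i +
          R * E i * ∑ b ∈ Finset.range i, (pruneSeq A b : ℝ) * θs b) * ∏ b ∈ Finset.range i, E b =
        (ηR + R * ∑ b ∈ Finset.range (i + 1), (pruneSeq A b : ℝ) * θs b) *
          ∏ b ∈ Finset.range (i + 1), E b := by
      rw [Finset.sum_range_succ, Finset.prod_range_succ]; ring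
    have hweq : w - βs i - ∑ b ∈ Finset.range i, βs b = w - ∑ b ∈ Finset.range (i + 1), βs b := by
      rw [Finset.sum_range_succ]; ring
    have hςeq : ς + h + i * h = ς + (i + 1 : ℕ) * h := by push_cast; ring
    have hη0 : 0 ≤ ((ηR + pruneSeq A i * (θs i * R)) * E i +
        R * E i * ∑ b ∈ Finset.range i, (pruneSeq A b : ℝ) * θs b) * ∏ b ∈ Finset.range i, E b := by
      have : 0 ≤ ∑ b ∈ Finset.range i, (pruneSeq A b : ℝ) * θs b :=
        Finset.sum_nonneg fun b _ => mul_nonneg (Nat.cast_nonneg _) (hθs b)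
      have := Finset.prod_nonneg fun b (_ : b ∈ Finset.range i) => hE0 b
      positivity
    refine ⟨?_, fun _ => ?_⟩
    · rw [sepBlockComp_succ, sepBlockComp_succ]
      exact ihT.mono le_rfl hη0 hηeq.le hC₀0 hweq.ge hςeq.le
    · rw [sepBlockComp_succ, sepBlockComp_succ]
      rcases Nat.eq_zero_or_pos i with hi | hi
      · subst hi
        have e1 : (ηR + pruneSeq A 0 * (θs 0 * R)) * E 0 =
            (ηR + R * ∑ b ∈ Finset.range (0 + 1), (pruneSeq A b : ℝ) * θs b) *
              ∏ b ∈ Finset.range (0 + 1), E b := by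
          rw [zero_add, Finset.sum_range_one, Finset.prod_range_one]; ring
        have e2 : w - ∑ b ∈ Finset.range (0 + 1), βs b = w - βs 0 := by
          rw [zero_add, Finset.sum_range_one]
        have e3 : ς + h = ς + ((0 + 1 : ℕ) : ℝ) * h := by push_cast; ring
        simp only [sepBlockComp_zero]
        exact hD.mono (by simp [pruneLevel_zero]) hηR' e1.le hC₀0 e2.le e3.le
      · exact (ihD hi).mono le_rfl hη0 hηeq.le hC₀0 hweq.ge hςeq.le

/-- **The comparison of the main terms of two coupled hierarchies** (BGSR Props. 5.3, 5.6, 5.7,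
abstract form): under the hypotheses of `isRelLevelBddT_sepBlockComp`, for `K ≥ 1` blocks and a
coupled one-particle pair `(Z, Y)` of horizon `σ ≥ ς + Kh`,
`|(sepBlockComp K [G₁])^{(1)}(Z) - (sepBlockComp K [G₂])^{(1)}(Y)| ≤
C₀ (η_R + R ∑_{b<K} n_b θ_b) ∏_{b<K} E_b` — the discrepancy of the data `η_R` and the
per-collision errors `θ_b` (bad sets, prefactors), each paid at most `n_b` times in block `b`,
times the product of the block factors `E_b = ∑_{j<n_b} (C₀ Λ_b h)^j/j!` of the continuity estimates
(printed, for both contributions: `A^{K(K+1)} (Cαt)^{A^{K+1}}` times `A^{2(K+1)} × (5.22)`, resp.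
`A^{2(K+1)}/N + αε`, times `‖ρ⁰‖_∞`). [cite: BodineauGallagherSaintRaymondInvent2016, §5.3.3 Props. 5.6-5.7, pp. 20–21] -/
theorem abs_sepBlockComp_sub_sepBlockComp_le (hδ : 0 ≤ δ) {A : ℕ} (hA : 1 ≤ A) {Ec bm C₀ : ℝ}
    (hbm : 0 < bm) (hC₀ : 1 ≤ C₀) (βs Λs θs Λrels Erels : ℕ → ℝ) (hβs : ∀ b, 0 < βs b)
    (hθs : ∀ b, 0 ≤ θs b)
    (hstep : ∀ b, 𝒞.RelStep Ec bm (βs b / pruneSeq A b) (pruneLevel A (b + 1)) (Λrels b) (Erels b))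
    (hV₁ : ∀ (k : ℕ) (g : Config (k + 1) d X → ℝ), (∀ Z, Ec < configEnergy Z → g Z = 0) →
      ∀ Z, Ec < configEnergy Z → M₁.op k g Z = 0)
    (hV₂ : ∀ (k : ℕ) (g : Config (k + 1) d X → ℝ), (∀ Z, Ec < configEnergy Z → g Z = 0) →
      ∀ Z, Ec < configEnergy Z → M₂.op k g Z = 0)
    (hΛ₁ : ∀ b, M₁.chainCost bm (βs b / pruneSeq A b) (pruneLevel A (b + 1)) ≤ Λs b)
    (hΛ₂ : ∀ b, M₂.chainCost bm (βs b / pruneSeq A b) (pruneLevel A (b + 1)) ≤ Λs b)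
    (hΛr : ∀ b, Λrels b ≤ Λs b) (hEθ : ∀ b, Erels b ≤ θs b * Λs b) {h : ℝ} (hh : δ ≤ h)
    {K : ℕ} (hK : 1 ≤ K) {G₁ G₂ : GCState d X} {R ηR w ς : ℝ} (hR : 0 ≤ R) (hηR : 0 ≤ ηR)
    (hς : 0 ≤ ς) (hw : bm + ∑ b ∈ Finset.range K, βs b ≤ w)
    (hn₁ : ∀ k, IsNice (G₁ k)) (hn₂ : ∀ k, IsNice (G₂ k))
    (hv₁ : ∀ (k : ℕ) (Z : Config k d X), Ec < configEnergy Z → G₁ k Z = 0)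
    (hv₂ : ∀ (k : ℕ) (Z : Config k d X), Ec < configEnergy Z → G₂ k Z = 0)
    (hb₁ : IsLevelBdd G₁ (pruneLevel A K) R C₀ w) (hb₂ : IsLevelBdd G₂ (pruneLevel A K) R C₀ w)
    (hrel : 𝒞.IsRelLevelBddT G₁ G₂ (pruneLevel A K) ηR C₀ w ς)
    {σ : ℝ} (p : Config 1 d X × Config 1 d X) (hp : p ∈ 𝒞.rel 1 σ) (hσ : ς + K * h ≤ σ) :
    |M₁.sepBlockComp δ (pruneSeq A) h K G₁ 1 p.1 - M₂.sepBlockComp δ (pruneSeq A) h K G₂ 1 p.2| ≤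
      C₀ * ((ηR + R * ∑ b ∈ Finset.range K, (pruneSeq A b : ℝ) * θs b) *
        ∏ b ∈ Finset.range K, ∑ j ∈ Finset.range (pruneSeq A b), (C₀ * Λs b * h) ^ j / j !) := by
  obtain ⟨-, hD⟩ := 𝒞.isRelLevelBddT_sepBlockComp hδ hA hbm hC₀ βs Λs θs Λrels Erels hβs hθs hstep hV₁
    hV₂ hΛ₁ hΛ₂ hΛr hEθ hh K G₁ G₂ R ηR w ς hR hηR hς hw hn₁ hn₂ hv₁ hv₂ hb₁ hb₂ hrel
  have key := hD hK 1 le_rfl σ p hp hσ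
  refine key.trans ?_
  have hw0 : 0 ≤ w - ∑ b ∈ Finset.range K, βs b := by linarith
  have hE := configEnergy_nonneg' p.2
  have hΛ0 : ∀ b, 0 ≤ Λs b := fun b => (M₁.chainCost_nonneg _ _ _).trans (hΛ₁ b)
  have hc0 : 0 ≤ (ηR + R * ∑ b ∈ Finset.range K, (pruneSeq A b : ℝ) * θs b) *
      ∏ b ∈ Finset.range K, ∑ j ∈ Finset.range (pruneSeq A b), (C₀ * Λs b * h) ^ j / j ! := by
    have : 0 ≤ ∑ b ∈ Finset.range K, (pruneSeq A b : ℝ) * θs b :=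
      Finset.sum_nonneg fun b _ => mul_nonneg (Nat.cast_nonneg _) (hθs b)
    have hC₀0 : 0 ≤ C₀ := zero_le_one.trans hC₀
    have hh0 : 0 ≤ h := hδ.trans hh
    have := Finset.prod_nonneg fun b (_ : b ∈ Finset.range K) =>
      Finset.sum_nonneg fun j (_ : j ∈ Finset.range (pruneSeq A b)) =>
        (by have := hΛ0 b; positivity : 0 ≤ (C₀ * Λs b * h) ^ j / (j ! : ℝ))
    positivity
  calc (ηR + R * ∑ b ∈ Finset.range K, (pruneSeq A b : ℝ) * θs b) *
        (∏ b ∈ Finset.range K, ∑ j ∈ Finset.range (pruneSeq A b), (C₀ * Λs b * h) ^ j / j !) *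
        C₀ ^ 1 * exp (-(w - ∑ b ∈ Finset.range K, βs b) * configEnergy p.2)
      ≤ (ηR + R * ∑ b ∈ Finset.range K, (pruneSeq A b : ℝ) * θs b) *
        (∏ b ∈ Finset.range K, ∑ j ∈ Finset.range (pruneSeq A b), (C₀ * Λs b * h) ^ j / j !) *
        C₀ ^ 1 * 1 := by
          have : 0 ≤ C₀ ^ 1 := by have := zero_le_one.trans hC₀; positivity
          gcongr
          exact exp_le_one_iff.2 (by nlinarith)
    _ = _ := by ring


end Coupling

end HierarchyModel

end Kinetic

end

end Literature.MathematicalPhysics.KineticTheory
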